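import Mathlib
import Summits.NavierStokesRegularity.NavierStokesRegularity.Theorems.ThreadingFluxHorizonTowerNullConeDivisibility
import Summits.NavierStokesRegularity.NavierStokesRegularity.Theorems.ThreadingFluxHorizonTowerQuadraticGeneratorBrackets
import Summits.NavierStokesRegularity.NavierStokesRegularity.Theorems.ThreadingFluxHorizonTowerQuadraticGeneratorOctic
import HarnessLib

/-!
# Crux `PoloidalLiouville` (stmt-NavierStokesRegularity-1222), crux idea «horizon-threading-tower» (ns-idea-15):
# THE SECOND CONE DIGIT of the bracket of two shells generated by one harmonic quadratic

Support file (`--supports stmt-NavierStokesRegularity-1222`, helper; cell `ns-wall-extremal`, width hand ns-wall-eng-3 g5; 0 kit), toward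
THM H «a finite tower whose top pair `(D′, D) = (2a, 2b)` has coprime `a < b` (`gcd(D′, D) = 2`) and no shell of degree `D′ − 2` is
coaxially zonal at order one» — WITHOUT explicit harmonic projections.

Let `L = xᵀQx` be the quadratic generator (`genL`), `M = |Qx|²`, `W = det(x,Qx,Q²x)`, `ρ = |x|²`.  For a solid harmonic
`P = γ L^{m+2} + ρ G` of degree `2m + 4`:
* ★ HARMONIC REMAINDER (`remainder_of_harmonic`): `(8m+14) G = −4(m+2)(m+1)γ · L^m M − ρ ΔG` (flat Laplacian of `L^{m+2}` by the
  Leibniz rules + Euler's identity `∇ρ·∇G = 2(deg G) G`);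
* ★★ SECOND DIGIT (`secondDigit_detP`): for two such shells `P₁ = γ₁L^{m+2} + ρG₁`, `P₂ = γ₂L^{n+2} + ρG₂`,
  `(8m+14)(8n+14) {P₁, P₂} = ρ · (96 (m+2)(n+2)(m−n) γ₁γ₂ · L^{m+n+1} W + ρ · S)` with `S` explicit — the bracket has one factor `ρ`
  and its second `ρ`-adic digit is a NON-ZERO multiple of `L^{m+n+1} W` when `m ≠ n`;
* ★ REALITY, general power (`exists_real_gen_of_chartT_map_eq_pow`): a non-zero real solid harmonic whose chart is `γ·(chartT L_ℂ)^k`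
  (`k ≥ 1`) has `L_ℂ = w • L_ℝ` (complex null-cone divisibility + conjugation + `exists_eq_C_mul_pow_of_pow_eq` with `d = 1`);
* ★ REAL COEFFICIENT AND REMAINDER (`exists_coeff_remainder_of_chartT_map_eq_pow`): then `P = g · L^k + ρ · G` over `ℝ`.

HONEST LABEL: polynomial algebra about one crux idea's typed objects; no Prop of the sketch is closed here; `HorizonTowerZonality`
(general towers), `PoloidalLiouville` (1222) OPEN; NS regularity NOT proved.  [folklore]
-/

-- the summit and its single sub-problem share the name (CONVENTIONS §1)
set_option linter.dupNamespace false

noncomputable section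

open MvPolynomial Complex
open scoped Polynomial

namespace Summit.NavierStokesRegularity.NavierStokesRegularity.Theorems.PoloidalLiouville.HorizonTower.Zonal

/-! ### Powers of the generator -/

section Powers

variable {R : Type*} [CommRing R] (a b d e f : R)

/-- `∇L·∇(L^{k+1}) = 4(k+1) L^k M`. [folklore] -/
theorem dotP_genL_pow (k : ℕ) :
    dotP (genL a b d e f) (genL a b d e f ^ (k + 1)) = C (4 * (k + 1 : R)) * genL a b d e f ^ k * genM a b d e f := by
  induction k with
  | zero =>
    rw [zero_add, pow_one, pow_zero, dotP_genL_genL]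
    simp only [map_mul, map_add, map_one, map_zero, map_ofNat, Nat.cast_zero]; ring
  | succ k ih =>
    rw [pow_succ, dotP_mul_right, ih, dotP_genL_genL]
    simp only [map_mul, map_add, map_natCast, map_one, map_ofNat, Nat.cast_succ]
    ring

/-- `Δ(L^{k+2}) = 4(k+2)(k+1) L^k M`. [folklore] -/
theorem lapP_genL_pow (k : ℕ) :
    lapP (genL a b d e f ^ (k + 2)) = C (4 * (k + 2 : R) * (k + 1)) * genL a b d e f ^ k * genM a b d e f := by
  induction k with
  | zero =>
    rw [zero_add, pow_two, lapP_mul, lapP_genL, dotP_genL_genL, pow_zero]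
    simp only [map_mul, map_add, map_one, map_zero, map_ofNat, Nat.cast_zero]; ring
  | succ k ih =>
    rw [show k + 1 + 2 = (k + 2) + 1 by ring, pow_succ, lapP_mul, lapP_genL, ih, show k + 2 = (k + 1) + 1 by ring, dotP_comm,
      dotP_genL_pow]
    simp only [map_mul, map_add, map_natCast, map_one, map_ofNat, Nat.cast_succ]
    ring

/-- `∇ρ·∇G = 2k G` for `G` homogeneous of degree `k` (Euler). [folklore] -/
theorem dotP_normSq_of_isHomogeneous {G : MvPolynomial (Fin 3) R} {k : ℕ} (hG : G.IsHomogeneous k) :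
    dotP normSq G = C (2 * (k : R)) * G := by
  have heuler := hG.sum_X_mul_pderiv
  rw [Fin.sum_univ_three, nsmul_eq_mul] at heuler
  rw [dotP, pderiv_zero_normSq, pderiv_one_normSq, pderiv_two_normSq]
  simp only [map_mul, map_ofNat, map_natCast]
  linear_combination (2 : MvPolynomial (Fin 3) R) * heuler

/-- `Δ(ρ G) = (4k + 6) G + ρ ΔG` for `G` homogeneous of degree `k`. [folklore] -/
theorem lapP_normSq_mul_of_isHomogeneous {G : MvPolynomial (Fin 3) R} {k : ℕ} (hG : G.IsHomogeneous k) :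
    lapP (normSq * G) = C (4 * (k : R) + 6) * G + normSq * lapP G := by
  rw [lapP_mul, lapP_normSq, dotP_normSq_of_isHomogeneous hG]
  simp only [map_add, map_mul, map_ofNat, map_natCast]
  ring

end Powers

/-! ### Real shells generated by `L`: harmonic remainder and the second digit -/

section Real

variable (a b d e f : ℝ)

/-- `detP P (X^{k+1}) = (k+1) X^k detP P X`. [folklore] -/
theorem detP_pow_right (P Y : RPoly) (k : ℕ) : detP P (Y ^ (k + 1)) = C ((k : ℝ) + 1) * Y ^ k * detP P Y := by
  induction k with
  | zero => simp only [zero_add, pow_one, pow_zero, Nat.cast_zero, map_one, one_mul]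
  | succ k ih =>
    rw [pow_succ, detP_mul_right, ih]
    simp only [map_add, map_natCast, map_one, Nat.cast_succ]
    ring

/-- `detP Y (Y^k) = 0`. [folklore] -/
theorem detP_pow_self (Y : RPoly) (k : ℕ) : detP Y (Y ^ k) = 0 := by
  induction k with
  | zero => rw [pow_zero, ← C_1, detP_C_right]
  | succ k ih => rw [pow_succ, detP_mul_right, detP_self, ih, mul_zero, mul_zero, add_zero]

/-- `detP (Y^{k+1}) P = (k+1) Y^k detP Y P`. [folklore] -/
theorem detP_pow_left (Y P : RPoly) (k : ℕ) : detP (Y ^ (k + 1)) P = C ((k : ℝ) + 1) * Y ^ k * detP Y P := by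
  rw [Zonal.detP_antisymm, detP_pow_right, Zonal.detP_antisymm P Y]; ring

/-- ★ **HARMONIC REMAINDER**: if `P = γ L^{m+2} + ρ G` (`G` homogeneous of degree `2m + 2`) is harmonic, then
`(8m + 14) G = −4(m+2)(m+1) γ L^m M − ρ ΔG`. [folklore] -/
theorem remainder_of_harmonic {P G : RPoly} {γ : ℝ} {m : ℕ} (hG : G.IsHomogeneous (2 * m + 2))
    (hP : P = C γ * genL a b d e f ^ (m + 2) + normSq * G) (hl : lapP P = 0) :
    C (8 * (m : ℝ) + 14) * G = -(C (4 * ((m : ℝ) + 2) * ((m : ℝ) + 1) * γ) * genL a b d e f ^ m * genM a b d e f)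
      - normSq * lapP G := by
  rw [hP, lapP_add, lapP_C_mul, lapP_genL_pow, lapP_normSq_mul_of_isHomogeneous hG] at hl
  simp only [map_mul, map_add, map_ofNat, map_natCast, Nat.cast_add, Nat.cast_mul, Nat.cast_ofNat] at hl ⊢
  linear_combination hl

/-- ★★ **THE SECOND CONE DIGIT.**  For two real harmonic shells `P₁ = γ₁ L^{m+2} + ρ G₁`, `P₂ = γ₂ L^{n+2} + ρ G₂` generated by the
same harmonic quadratic `L`:  `(8m+14)(8n+14) {P₁, P₂} = ρ (96 (m+2)(n+2)(m−n) γ₁γ₂ · L^{m+n+1} W + ρ S)` with the explicit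
remainder `S = −(8m+14)(m+2)γ₁ L^{m+1}{L, ΔG₂} + (8n+14)(n+2)γ₂ L^{n+1}{L, ΔG₁} + (8m+14)(8n+14){G₁, G₂}`. [folklore] -/
theorem secondDigit_detP {P₁ P₂ G₁ G₂ : RPoly} {γ₁ γ₂ : ℝ} {m n : ℕ}
    (hG₁ : G₁.IsHomogeneous (2 * m + 2)) (hG₂ : G₂.IsHomogeneous (2 * n + 2))
    (hP₁ : P₁ = C γ₁ * genL a b d e f ^ (m + 2) + normSq * G₁) (hP₂ : P₂ = C γ₂ * genL a b d e f ^ (n + 2) + normSq * G₂)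
    (hl₁ : lapP P₁ = 0) (hl₂ : lapP P₂ = 0) :
    C ((8 * (m : ℝ) + 14) * (8 * (n : ℝ) + 14)) * detP P₁ P₂
      = normSq * (C (96 * ((m : ℝ) + 2) * ((n : ℝ) + 2) * ((m : ℝ) - n) * γ₁ * γ₂) * genL a b d e f ^ (m + n + 1) * genW a b d e f
        + normSq * (-(C ((8 * (m : ℝ) + 14) * ((m : ℝ) + 2) * γ₁) * genL a b d e f ^ (m + 1) * detP (genL a b d e f) (lapP G₂))
          + C ((8 * (n : ℝ) + 14) * ((n : ℝ) + 2) * γ₂) * genL a b d e f ^ (n + 1) * detP (genL a b d e f) (lapP G₁)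
          + C ((8 * (m : ℝ) + 14) * (8 * (n : ℝ) + 14)) * detP G₁ G₂)) := by
  have hr₁ := remainder_of_harmonic a b d e f hG₁ hP₁ hl₁
  have hr₂ := remainder_of_harmonic a b d e f hG₂ hP₂ hl₂
  -- brackets of `L` with the remainders, scaled
  have hb₂ : C (8 * (n : ℝ) + 14) * detP (genL a b d e f) G₂
      = -(C (16 * ((n : ℝ) + 2) * ((n : ℝ) + 1) * γ₂) * genL a b d e f ^ n * genW a b d e f)
        - normSq * detP (genL a b d e f) (lapP G₂) := by
    rw [← detP_C_mul_right, hr₂]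
    simp only [detP_sub_right, detP_neg_right, detP_mul_right, detP_normSq_right, detP_C_right, detP_pow_self,
      detP_genL_genM, mul_zero, add_zero]
    simp only [map_mul, map_add, map_ofNat, map_natCast, map_one]
    ring
  have hb₁ : C (8 * (m : ℝ) + 14) * detP (genL a b d e f) G₁
      = -(C (16 * ((m : ℝ) + 2) * ((m : ℝ) + 1) * γ₁) * genL a b d e f ^ m * genW a b d e f)
        - normSq * detP (genL a b d e f) (lapP G₁) := by
    rw [← detP_C_mul_right, hr₁]
    simp only [detP_sub_right, detP_neg_right, detP_mul_right, detP_normSq_right, detP_C_right, detP_pow_self,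
      detP_genL_genM, mul_zero, add_zero]
    simp only [map_mul, map_add, map_ofNat, map_natCast, map_one]
    ring
  -- expand the bracket
  have hanti : detP G₁ (genL a b d e f) = -detP (genL a b d e f) G₁ := Zonal.detP_antisymm _ _
  have hexp : detP P₁ P₂ = normSq * (C (((m : ℝ) + 2) * γ₁) * genL a b d e f ^ (m + 1) * detP (genL a b d e f) G₂
      - C (((n : ℝ) + 2) * γ₂) * genL a b d e f ^ (n + 1) * detP (genL a b d e f) G₁ + normSq * detP G₁ G₂) := by
    rw [hP₁, hP₂, show m + 2 = (m + 1) + 1 by ring, show n + 2 = (n + 1) + 1 by ring]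
    simp only [detP_add_left, detP_add_right, detP_C_mul_left, detP_C_mul_right, detP_mul_left normSq, detP_mul_right _ normSq,
      detP_normSq_left, detP_normSq_right, detP_pow_left, detP_pow_right, detP_self, hanti, mul_zero, add_zero]
    simp only [map_mul, map_add, map_natCast, map_one, map_ofNat, Nat.cast_succ]
    ring
  -- assemble
  have key : C ((8 * (m : ℝ) + 14) * (8 * (n : ℝ) + 14)) * detP P₁ P₂
      = normSq * (C (((m : ℝ) + 2) * γ₁ * (8 * (m : ℝ) + 14)) * genL a b d e f ^ (m + 1)
          * (C (8 * (n : ℝ) + 14) * detP (genL a b d e f) G₂)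
        - C (((n : ℝ) + 2) * γ₂ * (8 * (n : ℝ) + 14)) * genL a b d e f ^ (n + 1) * (C (8 * (m : ℝ) + 14) * detP (genL a b d e f) G₁)
        + normSq * C ((8 * (m : ℝ) + 14) * (8 * (n : ℝ) + 14)) * detP G₁ G₂) := by
    rw [hexp]; simp only [map_mul, map_add, map_ofNat, map_natCast]; ring
  rw [key, hb₁, hb₂]
  simp only [map_mul, map_add, map_sub, map_ofNat, map_natCast, map_one]
  ring

end Real

/-! ### Reality of the generator from one power, and the real coefficient/remainder -/

/-- ★ **REALITY, general power.**  A non-zero real solid harmonic `P` whose chart is `γ · (chartT L_ℂ)^{k}` (`L_ℂ` a complex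
traceless symmetric generator, `k ≥ 1`) has `L_ℂ = w • L_ℝ`. [folklore] -/
theorem exists_real_gen_of_chartT_map_eq_pow {P : MvPolynomial (Fin 3) ℝ} {D k : ℕ} (hPh : P.IsHomogeneous D)
    (hPl : lapP P = 0) (hP0 : P ≠ 0) (hk : 1 ≤ k) (hD : D = 2 * k) {a b d e f γ : ℂ}
    (h : chartT (map (algebraMap ℝ ℂ) P) = Polynomial.C γ * chartT (genL a b d e f) ^ k) :
    ∃ (w : ℂ) (a' b' d' e' f' : ℝ), a = w * a' ∧ b = w * b' ∧ d = w * d' ∧ e = w * e' ∧ f = w * f' := by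
  subst hD
  set σ := starRingEnd ℂ with hσ
  set p : Polynomial ℂ := chartT (genL a b d e f) with hp
  set p' : Polynomial ℂ := chartT (genL (σ a) (σ b) (σ d) (σ e) (σ f)) with hp'
  have hPc0 : chartT (map (algebraMap ℝ ℂ) P) ≠ 0 := fun h0 => hP0 (eq_zero_of_chartT_map_eq_zero hPh hPl h0)
  have hγ : γ ≠ 0 := by rintro rfl; exact hPc0 (by rw [h, Polynomial.C_0, zero_mul])
  have hp0 : p ≠ 0 := by intro h0; exact hPc0 (by rw [h, h0, zero_pow (by omega), mul_zero])
  -- polynomial identity over `ℂ` by null-cone divisibility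
  obtain ⟨c, -, hc⟩ : ∃ c : MvPolynomial (Fin 3) ℂ, c.IsHomogeneous (2 * k - 2) ∧
      map (algebraMap ℝ ℂ) P - C γ * genL a b d e f ^ k = normSq * c := by
    refine exists_eq_normSq_mul_of_chartT_eq_zero' ((hPh.map _).sub ?_) ?_
    · simpa [mul_comm] using ((isHomogeneous_genL a b d e f).pow k).C_mul γ
    · rw [chartT_sub, chartT_mul, chartT_C, chartT_pow, ← hp, h, sub_self]
  -- conjugate
  have hconj : map (algebraMap ℝ ℂ) P - C (σ γ) * genL (σ a) (σ b) (σ d) (σ e) (σ f) ^ k = normSq * map σ c := by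
    have := congrArg (map σ) hc
    rw [map_sub, map_conj_map_ofReal, map_mul, map_C, map_pow, map_genL, map_mul, map_normSq] at this
    exact this
  -- compare charts: `γ p^k = σγ p'^k`
  have hpow : p' ^ k = Polynomial.C (γ / σ γ) * (p ^ 1) ^ k := by
    have h1 := congrArg chartT hc
    have h2 := congrArg chartT hconj
    rw [chartT_sub, chartT_mul, chartT_C, chartT_pow, ← hp, chartT_mul, chartT_normSq, zero_mul] at h1
    rw [chartT_sub, chartT_mul, chartT_C, chartT_pow, ← hp', chartT_mul, chartT_normSq, zero_mul] at h2
    have hσγ : σ γ ≠ 0 := (map_ne_zero σ).mpr hγ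
    have h3 : Polynomial.C (σ γ) * p' ^ k = Polynomial.C γ * p ^ k := by linear_combination h1 - h2
    have h4 : p' ^ k = Polynomial.C ((σ γ)⁻¹) * (Polynomial.C (σ γ) * p' ^ k) := by
      rw [← mul_assoc, ← Polynomial.C_mul, inv_mul_cancel₀ hσγ, Polynomial.C_1, one_mul]
    rw [h4, h3, pow_one, ← mul_assoc, ← Polynomial.C_mul, div_eq_mul_inv, mul_comm γ]
  obtain ⟨u, hu⟩ := exists_eq_C_mul_pow_of_pow_eq (D := k) (d := 1) hk hp0 hpow
  rw [pow_one] at hu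
  -- injectivity: `L_{σQ} = u L_Q`, componentwise
  have hcomp : σ a = u * a ∧ σ b = u * b ∧ σ d = u * d ∧ σ e = u * e ∧ σ f = u * f := by
    have h0 : genL (σ a - u * a) (σ b - u * b) (σ d - u * d) (σ e - u * e) (σ f - u * f) = 0 := by
      refine eq_zero_of_chartT_eq_zero (isHomogeneous_genL _ _ _ _ _) (lapP_genL _ _ _ _ _) ?_
      rw [genL_sub, genL_smul, chartT_sub, chartT_mul, chartT_C, ← hp, ← hp', hu, sub_self]
    obtain ⟨h1, h2, h3, h4, h5⟩ := gen_eq_zero_of_genL_eq_zero h0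
    exact ⟨sub_eq_zero.mp h1, sub_eq_zero.mp h2, sub_eq_zero.mp h3, sub_eq_zero.mp h4, sub_eq_zero.mp h5⟩
  by_cases hz : a = 0 ∧ b = 0 ∧ d = 0 ∧ e = 0 ∧ f = 0
  · obtain ⟨rfl, rfl, rfl, rfl, rfl⟩ := hz
    exact ⟨1, 0, 0, 0, 0, 0, by simp, by simp, by simp, by simp, by simp⟩
  have hunit : ‖u‖ = 1 := by
    obtain ⟨z, hz0, hzσ⟩ : ∃ z : ℂ, z ≠ 0 ∧ σ z = u * z := by
      simp only [not_and_or] at hz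
      rcases hz with h1 | h1 | h1 | h1 | h1
      · exact ⟨a, h1, hcomp.1⟩
      · exact ⟨b, h1, hcomp.2.1⟩
      · exact ⟨d, h1, hcomp.2.2.1⟩
      · exact ⟨e, h1, hcomp.2.2.2.1⟩
      · exact ⟨f, h1, hcomp.2.2.2.2⟩
    have h1 := congrArg (fun t : ℂ => ‖t‖) hzσ
    simp only [norm_mul, hσ, Complex.norm_conj] at h1
    have hz' : ‖z‖ ≠ 0 := norm_ne_zero_iff.mpr hz0
    field_simp at h1
    linarith [h1]
  obtain ⟨w, hw⟩ := IsAlgClosed.exists_pow_nat_eq u (by norm_num : 0 < 2)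
  have hwunit : ‖w‖ = 1 := by
    have h1 := congrArg (fun t : ℂ => ‖t‖) hw
    simp only [norm_pow, hunit] at h1
    nlinarith [norm_nonneg w, h1]
  have hw0 : w ≠ 0 := fun h0 => by rw [h0, norm_zero] at hwunit; exact zero_ne_one hwunit
  have hwσ : σ w * w = 1 := by
    rw [hσ, mul_comm, Complex.mul_conj, Complex.normSq_eq_norm_sq, hwunit]; simp
  have hreal : ∀ z : ℂ, σ z = u * z → ∃ r : ℝ, z = w⁻¹ * r := by
    intro z hzσ
    refine ⟨(w * z).re, ?_⟩
    have hfix : σ (w * z) = w * z := by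
      rw [map_mul, hzσ, ← hw]
      linear_combination (w * z) * hwσ
    have hre : ((w * z).re : ℂ) = w * z := Complex.conj_eq_iff_re.mp hfix
    rw [hre, ← mul_assoc, inv_mul_cancel₀ hw0, one_mul]
  obtain ⟨ra, hra⟩ := hreal a hcomp.1
  obtain ⟨rb, hrb⟩ := hreal b hcomp.2.1
  obtain ⟨rd, hrd⟩ := hreal d hcomp.2.2.1
  obtain ⟨re', hre'⟩ := hreal e hcomp.2.2.2.1
  obtain ⟨rf, hrf⟩ := hreal f hcomp.2.2.2.2
  exact ⟨w⁻¹, ra, rb, rd, re', rf, hra, hrb, hrd, hre', hrf⟩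

/-- ★ **REAL COEFFICIENT AND REMAINDER.**  A real solid harmonic `P` of degree `2k` whose chart is `γ · (chartT L)^k` for a REAL
generator `L` (`γ` a priori complex) is `g · L^k + ρ · G` over `ℝ` with `g` real and `G` homogeneous of degree `2k − 2`. [folklore] -/
theorem exists_coeff_remainder_of_chartT_map_eq_pow {P : MvPolynomial (Fin 3) ℝ} {D k : ℕ} (hPh : P.IsHomogeneous D)
    (hD : D = 2 * k) {a b d e f : ℝ} {γ : ℂ} (hL : genL a b d e f ≠ 0)
    (h : chartT (map (algebraMap ℝ ℂ) P) = Polynomial.C γ * chartT (map (algebraMap ℝ ℂ) (genL a b d e f)) ^ k) :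
    ∃ (g : ℝ) (G : MvPolynomial (Fin 3) ℝ), G.IsHomogeneous (2 * k - 2) ∧ P = C g * genL a b d e f ^ k + normSq * G := by
  subst hD
  set σ := starRingEnd ℂ with hσ
  have hLk : (C γ * map (algebraMap ℝ ℂ) (genL a b d e f) ^ k).IsHomogeneous (2 * k) := by
    simpa [mul_comm] using (((isHomogeneous_genL a b d e f).map (algebraMap ℝ ℂ)).pow k).C_mul γ
  obtain ⟨c, -, hc⟩ : ∃ c : MvPolynomial (Fin 3) ℂ, c.IsHomogeneous (2 * k - 2) ∧
      map (algebraMap ℝ ℂ) P - C γ * map (algebraMap ℝ ℂ) (genL a b d e f) ^ k = normSq * c :=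
    exists_eq_normSq_mul_of_chartT_eq_zero' ((hPh.map _).sub hLk)
      (by rw [chartT_sub, chartT_mul, chartT_C, chartT_pow, h, sub_self])
  -- `γ` is real: conjugate and compare charts
  have hγ : σ γ = γ := by
    have h1 := congrArg (map σ) hc
    rw [map_sub, map_conj_map_ofReal, map_mul, map_C, map_pow, map_conj_map_ofReal, map_mul, map_normSq] at h1
    have h2 : C (γ - σ γ) * map (algebraMap ℝ ℂ) (genL a b d e f) ^ k = normSq * (map σ c - c) := by
      rw [map_sub, sub_mul, mul_sub]; linear_combination h1 - hc
    have h3 := congrArg chartT h2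
    rw [chartT_mul, chartT_C, chartT_pow, chartT_mul, chartT_normSq, zero_mul] at h3
    have hLc : chartT (map (algebraMap ℝ ℂ) (genL a b d e f)) ≠ 0 := fun h0 =>
      hL (eq_zero_of_chartT_map_eq_zero (isHomogeneous_genL a b d e f) (lapP_genL a b d e f) h0)
    have h4 := (mul_eq_zero.mp h3).resolve_right (pow_ne_zero k hLc)
    rw [Polynomial.C_eq_zero, sub_eq_zero] at h4
    exact h4.symm
  have hγre : ((γ.re : ℝ) : ℂ) = γ := Complex.conj_eq_iff_re.mp hγ
  -- real divisibility
  have hh : (C γ.re * genL a b d e f ^ k).IsHomogeneous (2 * k) := by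
    simpa [mul_comm] using ((isHomogeneous_genL a b d e f).pow k).C_mul γ.re
  obtain ⟨G, hG, hPG⟩ := exists_eq_normSq_mul_of_chartT_map_eq_zero' (hPh.sub hh) (by
      rw [map_sub, map_mul, map_C, map_pow, show (algebraMap ℝ ℂ) γ.re = γ from hγre, chartT_sub, chartT_mul, chartT_C,
        chartT_pow, h, sub_self])
  exact ⟨γ.re, G, hG, by rw [← hPG]; ring⟩

end Summit.NavierStokesRegularity.NavierStokesRegularity.Theorems.PoloidalLiouville.HorizonTower.Zonal

end
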